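import Literature.NumberTheory.Automorphic.Liu2021.Thm418CyclotomicUnitsLocalNormsDyadic
import Literature.NumberTheory.Automorphic.Liu2021.Thm418CyclotomicUnitIsLocalNormOdd
import Literature.NumberTheory.Automorphic.Liu2021.LemD1AsPrintedIndexedNonVacuityNonsplitPlace
import Literature.NumberTheory.Automorphic.AdelicAdditiveCharacterGaloisTwist
import HarnessLib

/-!
# [Liu2021, Thm 4.18 (3), proof l. 2279–2289] — (NT) at the DYADIC places in the currency of the Galois twist of the
# local additive character, modulo the projection formula of local class field theory at `2`

Topic `NumberTheory/Automorphic/Liu2021`; namespace `Literature.NumberTheory.Automorphic.Liu2021`.  THEOREMS ONLY (no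
definition, no named fact of its own, no `sorry`): the dyadic twin of `Thm418CyclotomicUnitIsLocalNormOdd`
(`exists_mul_conjLocal_eq_of_adeleAddCharAt_galoisTwist`, `𝔭 ∤ 2`): for `L` CM, `ψ = μ` conjugate symplectic, `σ : ℂ ≃+* ℂ`
fixing `M_μ = fieldOfValues L ψ` pointwise, `𝔭 ∣ 2` a place of `L⁺` and `κ ∈ L⁺_𝔭` with `σ(ψ_𝔭(r)) = ψ_𝔭(κ r)` for all `r`
(`ψ_𝔭 = adeleAddCharAt L⁺ 𝔭`), the element `κ` — necessarily `χ_{cyc,2}(σ)` read in `L⁺_𝔭`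
(`ringEquiv_adeleAddCharAt_eq_cyclotomicCharacter_mul`, B-p13) — is a NORM from the place model
`E_𝔭 = L ⊗_{L⁺} L⁺_𝔭` (`UnitaryGroup.LocalRing`, conjugation `conjLocal`), PROVIDED the projection formula
`QuadraticForms.HilbertSymbolNormCompatAtTwo` («`(a, b)_K = (a, N_{K/ℚ₂} b)_{ℚ₂}`», [NeukirchANT1999] IV (6.4), V (3.1)–(3.2);
a NAMED FACT of the tree, taken as the explicit hypothesis `hNC`).  The mathematics is
`Thm418CyclotomicUnitsLocalNormsDyadic.hilbertSymbol_cyclotomicCharacter_cmQuadraticGenerator_eq_one_of_normCompatAtTwo`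
(`(χ_{cyc,2}(σ), θ)_𝔭 = 1`) + O'Meara 63:10 (`(t, θ)_𝔭 = 1 ⟺ t ∈ N(L⁺_𝔭(√θ))`) + the place model
(`LemD1IndexedNonVacuityNonsplitPlace.isNorm_iff_mem_quadraticNormSubgroup`).  Cell `hodgecm-mathlib` (D-0151), row III-11c
`CyclotomicUnitIsLocalNormDyadic` (A-p19's `A3Liu418EpsRigidFaceTypes`); HC_CM is proved only modulo the 7 printed
citations until rung 0 closes.

## References
* [Liu2021] Y. Liu, *Fourier–Jacobi cycles and arithmetic relative trace formula*, Camb. J. Math. 9 (2021), proof of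
  Thm. 4.18 (3), TeX l. 2279–2289.
* [NeukirchANT1999] J. Neukirch, *Algebraic Number Theory* (1999), IV (6.4), V (3.1)–(3.2).
* [Omeara1963] O. T. O'Meara, *Introduction to Quadratic Forms* (1963), §63B 63:10.
-/

set_option autoImplicit false

noncomputable section

open scoped NumberField Valued
open NumberField IsDedekindDomain IsDedekindDomain.HeightOneSpectrum

namespace Literature.NumberTheory.Automorphic.Liu2021

open Literature.NumberTheory.QuadraticForms Literature.NumberTheory.GaloisRepresentations
open Literature.NumberTheory.Automorphic UnitaryGroup

variable {L : Type} [Field L] [NumberField L] [IsCMField L]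

local notation3 "L⁺" => maximalRealSubfield L

open IdeleClassGroup in
/-- **[Liu2021, Thm. 4.18 (3), (NT) at `𝔭 ∣ 2`, road currency] modulo the LOCAL projection formula at `𝔭`** — the same as
`exists_mul_conjLocal_eq_of_adeleAddCharAt_galoisTwist_of_normCompatAtTwo` below with the named fact weakened to its one
instance used, `(a, b)_𝔭 = (a, N_{L⁺_𝔭/ℚ₂} b)_{ℚ₂}` for this completion with its canonical `ℚ₂`-structure (the shape of the
cell's LCFT-free discharge for completions of number fields, `hilbertSymbol_normCompat_adicCompletion_two`).
[cite: Liu2021, proof of Thm. 4.18 (3), l. 2279–2289] [cite: NeukirchANT1999, IV (6.4) and V (3.1)–(3.2)] -/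
theorem exists_mul_conjLocal_eq_of_adeleAddCharAt_galoisTwist_of_localNormCompat
    {ψ : IdeleClassGroup L →ₜ* Circle} (hψ : IsConjugateSymplectic L ψ)
    (σ : ℂ ≃+* ℂ) (hσ : ∀ z ∈ fieldOfValues L ψ, σ z = z)
    (𝔭 : HeightOneSpectrum (𝓞 L⁺)) (h2 : ((2 : ℕ) : 𝓞 L⁺) ∈ 𝔭.asIdeal)
    (hP : letI := LocalField.adicCompletionPadicAlgebra 𝔭 2 h2
      ∀ (a : ℚ_[2]) (b : 𝔭.adicCompletion L⁺), a ≠ 0 → b ≠ 0 →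
        hilbertSymbol (𝔭.adicCompletion L⁺) (algebraMap ℚ_[2] (𝔭.adicCompletion L⁺) a) b =
          hilbertSymbol ℚ_[2] a (Algebra.norm ℚ_[2] b))
    (κ : 𝔭.adicCompletion L⁺)
    (hκ : ∀ r : 𝔭.adicCompletion L⁺, σ (adeleAddCharAt (L⁺) 𝔭 r : ℂ) = adeleAddCharAt (L⁺) 𝔭 (κ * r)) :
    ∃ x : (LocalRing L 𝔭)ˣ,
      (x : LocalRing L 𝔭) * conjLocal L (IsCMField.complexConj L) 𝔭 x =
        algebraMap (𝔭.adicCompletion L⁺) (LocalRing L 𝔭) κ := by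
  classical
  letI := LocalField.adicCompletionPadicAlgebra 𝔭 2 h2
  haveI : CharZero (𝔭.adicCompletion L⁺) := charZero_of_injective_algebraMap (algebraMap (L⁺) _).injective
  haveI : NeZero (2 : 𝔭.adicCompletion L⁺) := ⟨two_ne_zero⟩
  -- `κ = χ_{cyc,2}(σ)` by non-degeneracy of `ψ_𝔭`
  set κ₀ : 𝔭.adicCompletion L⁺ :=
    algebraMap ℚ_[2] (𝔭.adicCompletion L⁺) (((cyclotomicCharacter ℂ 2 σ : ℤ_[2]ˣ) : ℤ_[2]) : ℚ_[2]) with hκ₀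
  have hκeq : κ = κ₀ := by
    refine eq_of_forall_adeleAddCharAt_mul_eq 𝔭 fun r => ?_
    apply Subtype.ext
    rw [← hκ r]
    exact ringEquiv_adeleAddCharAt_eq_cyclotomicCharacter_mul (L⁺) 𝔭 h2 σ r
  have hu0 : ((((cyclotomicCharacter ℂ 2 σ : ℤ_[2]ˣ) : ℤ_[2]) : ℚ_[2])) ≠ 0 :=
    PadicInt.coe_ne_zero.mpr (Units.ne_zero _)
  have hκ0 : κ ≠ 0 := by
    rw [hκeq]
    exact (map_ne_zero _).mpr hu0
  -- `θ ≠ 0` in `L⁺_𝔭`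
  have hθF0 : ((cmQuadraticGenerator L : 𝓞 L⁺) : L⁺) ≠ 0 := by
    exact_mod_cast RingOfIntegers.ne_zero_of_not_isSquare (L⁺) (not_isSquare_cmQuadraticGenerator L)
  have hθK0 : algebraMap (L⁺) (𝔭.adicCompletion L⁺) ((cmQuadraticGenerator L : 𝓞 L⁺) : L⁺) ≠ 0 :=
    (map_ne_zero _).mpr hθF0
  -- (NT) dyadic: `(κ, θ)_𝔭 = 1`, i.e. `κ ∈ N(L⁺_𝔭(√θ))`
  have hsym : hilbertSymbol (𝔭.adicCompletion L⁺) κ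
      (algebraMap (L⁺) (𝔭.adicCompletion L⁺) ((cmQuadraticGenerator L : 𝓞 L⁺) : L⁺)) = 1 := by
    rw [hκeq]
    exact hilbertSymbol_cyclotomicCharacter_cmQuadraticGenerator_eq_one_of_localNormCompat hψ σ hσ 𝔭 h2 hP
  have hmem : Units.mk0 κ hκ0 ∈ quadraticNormSubgroup (𝔭.adicCompletion L⁺)
      (algebraMap (L⁺) (𝔭.adicCompletion L⁺) ((cmQuadraticGenerator L : 𝓞 L⁺) : L⁺)) :=
    (hilbertSymbol_eq_one_iff_mem_quadraticNormSubgroup hθK0 _).mp (by rw [Units.val_mk0]; exact hsym)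
  -- the place model: `x x̄ = a ↔ a ∈ N(L⁺_𝔭(√θ))`, `θ = α²`
  obtain ⟨α, hα0, hαc, hαsq⟩ := cmQuadraticGenerator_spec L
  have hd : α * α = algebraMap (L⁺) L ((cmQuadraticGenerator L : 𝓞 L⁺) : L⁺) := by rw [← sq, hαsq]
  have hiff := LemD1IndexedNonVacuityNonsplitPlace.isNorm_iff_mem_quadraticNormSubgroup L 𝔭 (IsCMField.complexConj L)
    hαc hα0 hd (Units.mk0 κ hκ0)
  rw [Units.val_mk0] at hiff
  exact hiff.mpr (by simpa only [HeightOneSpectrum.algebraMap_adicCompletion, Function.comp_apply, Algebra.algebraMap_self,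
    RingHom.id_apply] using hmem)

open IdeleClassGroup in
/-- **[Liu2021, Thm. 4.18 (3), (NT) at `𝔭 ∣ 2`, road currency] modulo `HilbertSymbolNormCompatAtTwo`**: for `ψ = μ` conjugate
symplectic, `σ : ℂ ≃+* ℂ` fixing `fieldOfValues L ψ` pointwise, `𝔭 ∣ 2` a place of `L⁺` and `κ ∈ L⁺_𝔭` with
`σ(ψ_𝔭(r)) = ψ_𝔭(κ r)` for all `r`: `∃ x : (LocalRing L 𝔭)ˣ, x · conjLocal x = κ` — `κ = χ_{cyc,2}(σ)` by non-degeneracy of `ψ_𝔭`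
and B-p13's `ringEquiv_adeleAddCharAt_eq_cyclotomicCharacter_mul`, `(κ, θ)_𝔭 = 1` by
`hilbertSymbol_cyclotomicCharacter_cmQuadraticGenerator_eq_one_of_normCompatAtTwo`, then O'Meara 63:10 and the place model.
[cite: Liu2021, proof of Thm. 4.18 (3), l. 2279–2289] [cite: NeukirchANT1999, IV (6.4) and V (3.1)–(3.2)] -/
theorem exists_mul_conjLocal_eq_of_adeleAddCharAt_galoisTwist_of_normCompatAtTwo
    (hNC : HilbertSymbolNormCompatAtTwo)
    {ψ : IdeleClassGroup L →ₜ* Circle} (hψ : IsConjugateSymplectic L ψ)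
    (σ : ℂ ≃+* ℂ) (hσ : ∀ z ∈ fieldOfValues L ψ, σ z = z)
    (𝔭 : HeightOneSpectrum (𝓞 L⁺)) (h2 : (2 : 𝓞 L⁺) ∈ 𝔭.asIdeal)
    (κ : 𝔭.adicCompletion L⁺)
    (hκ : ∀ r : 𝔭.adicCompletion L⁺, σ (adeleAddCharAt (L⁺) 𝔭 r : ℂ) = adeleAddCharAt (L⁺) 𝔭 (κ * r)) :
    ∃ x : (LocalRing L 𝔭)ˣ,
      (x : LocalRing L 𝔭) * conjLocal L (IsCMField.complexConj L) 𝔭 x =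
        algebraMap (𝔭.adicCompletion L⁺) (LocalRing L 𝔭) κ := by
  have hp : ((2 : ℕ) : 𝓞 L⁺) ∈ 𝔭.asIdeal := by exact_mod_cast h2
  letI := LocalField.adicCompletionPadicAlgebra 𝔭 2 hp
  haveI : CharZero (𝔭.adicCompletion L⁺) := charZero_of_injective_algebraMap (algebraMap (L⁺) _).injective
  haveI : FiniteDimensional ℚ_[2] (𝔭.adicCompletion L⁺) := by
    haveI := 𝔭.isPrime
    refine Module.finite_of_finrank_pos ?_
    rw [Literature.NumberTheory.NumberFields.finrank_adicCompletionPadicAlgebra_eq 2 𝔭 hp]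
    exact Nat.mul_pos (Ideal.ramificationIdx_pos _ _) (Ideal.inertiaDeg_pos _ _)
  exact exists_mul_conjLocal_eq_of_adeleAddCharAt_galoisTwist_of_localNormCompat hψ σ hσ 𝔭 hp
    (fun a b ha hb => hNC (𝔭.adicCompletion L⁺) a b ha hb) κ hκ

end Literature.NumberTheory.Automorphic.Liu2021

end
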